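import Literature.NumberTheory.DiophantineGeometry.MordellAlmostPrimitiveHeightBoundsProofs
import HarnessLib

/-!
# von Känel–Matschke, Corollary 7.3 (the difference of perfect squares and perfect cubes) from the
# §10 roots (proofs)

Topic `Literature/NumberTheory/DiophantineGeometry` (family `abc`). A proofs-only companion (theorems only; NO
definition, NO new named fact; D-0014, D-0026) of `MordellThueRamanujanNagellHeightBounds.lean`, where
**Corollary 7.3** (`cor:coates1`) of R. von Känel, B. Matschke, *Solving `S`-unit, Mordell, Thue, Thue–Mahler and
generalized Ramanujan–Nagell equations via Shimura–Taniyama conjecture*, arXiv:1605.06079 = Mem. AMS 286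
(2023), no. 1419 [`VonkanelMatschke2023`] is typed as the named fact `corollary_7_3`:
*"If `(x, y) ∈ ℤ × ℤ` with `y² − x³ = a` and `gcd(x, y, N_S) = 1`, then
`log max(|x|,|y|) ≤ ½ log|a/f| + 2 α_S log α_S + ¾ α_S log log log α_S + 6 α_S`"* (`a ∈ ℤ ∖ {0}`, `f` the
largest divisor of `a` composed of primes in `S`, `α_S = a_S/N_S = 1728 N_S r₂(a)`).

## The printed proof (§10.3, "Proof of Corollary (cor:coates1)") and how it is followed

1. *"Let `m = u₂ ∈ ℤ` be maximal such that `m⁶ ∣ gcd(x³, y²)`, and define `x' = m⁻²x` and `y' = m⁻³y`. Then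
   `(x', y') ∈ ℤ × ℤ` is a primitive solution of `y'² = x'³ + a'` for `a' = m⁻⁶a ∈ ℤ`."* —
   `exists_primitive_reduction_int` (Definition 7.1 for integers: `u₁ = 1`, `u_{x,y} = 1/m`).
2. *"`gcd(x, y, N_S) = 1` together with `rad(f) ∣ N_S` implies that `gcd(x, y, f) = 1`, and hence `gcd(m, f) = 1`
   since `m` divides `x` and `y`. Thus on using that `m⁶ ∣ a`, we see that `m⁶` divides `a/f`. This shows that
   … `h(u_{x,y}) ≤ μ = (1/6) log|a/f|`."* — `sPart_dvd_natAbs`, and the step `6 log m ≤ log(|a|/f)` inside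
   `corollary_7_3_of_roots`.
3. *"Lemma 10.4 (ii) gives that `E` is semi-stable at each `p ∈ S` with `p ≥ 5`, since `gcd(x', y', N_S) = 1`. Then
   (the proof of) Lemma 10.3 shows that `N_E` divides `6 · 1728 N_S r₂(a')`, and hence we obtain that
   `N_E ∣ 6α_S` since `a' ∣ a`."* — `conductorNorm_dvd_six_mul_alphaLevel` (semistable `⇒ f_p ≤ 1`, Silverman
   ATAEC IV.10.2, the discharged facts `conductorExponent_eq_zero_iff_holds`, `conductorExponent_eq_one_iff_holds`;
   `N_E ∣ a'_S ∣ a_S = N_S α_S`, `mordellLevel_intCast_dvd_of_dvd`; `N_E = ∏ p^{f_p}`).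
4. *"Thus, on replacing `a_S` by `6α_S = 6a_S/N_S` in the proof of Theorem 7.2 (i) and on taking
   `μ = (1/6) log|a/f|`, we deduce Corollary 7.3."* — the kernel of the tree's proof of Thm. 7.2 (i)
   (`MordellAlmostPrimitiveHeightBoundsProofs`: `nu_terms_le` with `M = 6α_S`, `two_mul_height_le_of_prop_10_8_i`,
   `two_log_max_le_of_two_mul_le`, Lemma 10.4 (iii)) gives `max(h(x'), (2/3)h(y')) ≤ B` with
   `(3/2)B ≤ 3κ + (1/3)M log M + (1/8)M log₃M + (2/9 + 1/288)M + 66 log 2 + 36`, `M = 6α_S`; with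
   `log(6α) = log α + log 6`, `log₃(6α) ≤ log₃ α + 0.28` (`α ≥ 1728`) this is
   `≤ 2α log α + (3/4)α log₃α + 5.73α + 131.3 ≤ 2α log α + (3/4)α log₃α + 6α`; finally
   `h(x) ≤ 2 log m + h(x')`, `h(y) ≤ 3 log m + h(y')`, `3 log m ≤ ½ log|a/f|` and
   `log max(|x|,|y|) ≤ max(h(x), h(y))`.

## Main result

`corollary_7_3_of_roots (hmod) (h104 : vonKanelMatschke_lemma_10_4) (hi : vonKanelMatschke_prop_10_8_i) :
corollary_7_3` — Corollary 7.3 from {modularity `nonempty_modularParametrizationData`, Lemma 10.4,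
Prop. 10.8 (i)} (Prop. 10.8 (ii), (eq:nuineq), the conductor facts being theorems of the tree). No `abc` claim;
axioms standard.
-/

noncomputable section

open Height WeierstrassCurve IsDedekindDomain Rat.HeightOneSpectrum
open Literature.NumberTheory.EllipticCurves.ModularForms
open Literature.NumberTheory.EllipticCurves

namespace Literature.NumberTheory.DiophantineGeometry

namespace VonKanelMatschke

/-! ### Real-analysis helpers -/

/-- `log 1728 ≥ 7.43`. [folklore] -/
private theorem log_1728_ge' : (7.43 : ℝ) ≤ Real.log 1728 := by
  have hl2 := Real.log_two_gt_d9
  have he := Real.exp_one_lt_d9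
  have h1 : Real.log 1728 = 10 * Real.log 2 + Real.log 1.6875 := by
    rw [show (1728 : ℝ) = 2 ^ 10 * 1.6875 by norm_num, Real.log_mul (by norm_num) (by norm_num),
      Real.log_pow]; push_cast; ring
  have h2 : (1 / 2 : ℝ) ≤ Real.log 1.6875 := by
    rw [Real.le_log_iff_exp_le (by norm_num)]
    have hsq : Real.exp (1 / 2) ^ 2 = Real.exp 1 := by rw [← Real.exp_nat_mul]; norm_num
    have hpos : 0 < Real.exp (1 / 2 : ℝ) := Real.exp_pos _
    nlinarith
  rw [h1]; linarith

/-- `log(A + B) ≤ log A + B/A` for `A > 0`, `B ≥ 0` (`log(1 + t) ≤ t`). [folklore] -/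
private theorem log_add_le_add_div {A B : ℝ} (hA : 0 < A) (hB : 0 ≤ B) :
    Real.log (A + B) ≤ Real.log A + B / A := by
  have h1 : Real.log (A + B) - Real.log A = Real.log ((A + B) / A) :=
    (Real.log_div (by positivity) hA.ne').symm
  have h2 : Real.log ((A + B) / A) ≤ (A + B) / A - 1 := Real.log_le_sub_one_of_pos (by positivity)
  have h3 : (A + B) / A - 1 = B / A := by field_simp; ring
  linarith

/-- `log₃(6α) ≤ log₃ α + 0.28` for `α ≥ 1728` (`log log α ≥ 1`, `log 6/log α ≤ 2.08/7.43`). [folklore] -/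
private theorem l3_six_mul_le {α : ℝ} (hα : 1728 ≤ α) :
    Real.log (Real.log (Real.log (6 * α))) ≤ Real.log (Real.log (Real.log α)) + 0.28 := by
  have hl2 := Real.log_two_lt_d9
  have he := Real.exp_one_lt_d9
  have hα0 : 0 < α := by linarith
  have hlogα : 7.43 ≤ Real.log α := log_1728_ge'.trans (Real.log_le_log (by norm_num) hα)
  have hlog6 : Real.log 6 ≤ 2.08 := by
    have h : Real.log (6 : ℝ) ≤ Real.log 8 := Real.log_le_log (by norm_num) (by norm_num)
    rw [show (8 : ℝ) = 2 ^ 3 by norm_num, Real.log_pow] at h; push_cast at h; linarith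
  have hlog6' : 0 ≤ Real.log 6 := Real.log_nonneg (by norm_num)
  have hll : 1 ≤ Real.log (Real.log α) := by
    rw [Real.le_log_iff_exp_le (by linarith)]; linarith
  have e1 : Real.log (6 * α) = Real.log α + Real.log 6 := by
    rw [Real.log_mul (by norm_num) hα0.ne']; ring
  have s2 : Real.log (Real.log (6 * α)) ≤ Real.log (Real.log α) + Real.log 6 / Real.log α := by
    rw [e1]; exact log_add_le_add_div (by linarith) hlog6'
  have hd0 : 0 ≤ Real.log 6 / Real.log α := div_nonneg hlog6' (by linarith)
  have hd : Real.log 6 / Real.log α ≤ 0.28 := by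
    rw [div_le_iff₀ (by linarith)]; linarith
  have hpos1 : 0 < Real.log (Real.log (6 * α)) := by
    have : 1 < Real.log (6 * α) := by rw [e1]; linarith
    exact Real.log_pos this
  have s3 : Real.log (Real.log (Real.log (6 * α))) ≤
      Real.log (Real.log (Real.log α) + Real.log 6 / Real.log α) := Real.log_le_log hpos1 s2
  have s4 : Real.log (Real.log (Real.log α) + Real.log 6 / Real.log α) ≤
      Real.log (Real.log (Real.log α)) + (Real.log 6 / Real.log α) / Real.log (Real.log α) :=
    log_add_le_add_div (by linarith) hd0
  have s5 : (Real.log 6 / Real.log α) / Real.log (Real.log α) ≤ Real.log 6 / Real.log α :=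
    div_le_self hd0 hll
  linarith

/-- `log max(|x|, |y|) ≤ max(h(x), h(y))` for integers (`h(z) = log max(1, |z|)`; `log 0 = 0`). [folklore] -/
private theorem log_max_abs_le (x y : ℤ) :
    Real.log ((max |x| |y| : ℤ) : ℝ) ≤ max (logHeight₁ (x : ℚ)) (logHeight₁ (y : ℚ)) := by
  have hx : logHeight₁ (x : ℚ) = Real.log (max |(x : ℝ)| 1) := by
    rw [Rat.logHeight₁_eq_log_max]; simp
  have hy : logHeight₁ (y : ℚ) = Real.log (max |(y : ℝ)| 1) := by
    rw [Rat.logHeight₁_eq_log_max]; simp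
  have hx0 : 0 ≤ logHeight₁ (x : ℚ) := zero_le_logHeight₁ _
  have e : ((max |x| |y| : ℤ) : ℝ) = max |(x : ℝ)| |(y : ℝ)| := by push_cast; rfl
  rw [e]
  by_cases h1 : max |(x : ℝ)| |(y : ℝ)| ≤ 1
  · exact (Real.log_nonpos (by positivity) h1).trans (hx0.trans (le_max_left _ _))
  · push Not at h1
    rcases le_total |(y : ℝ)| |(x : ℝ)| with hyx | hxy
    · rw [max_eq_left hyx] at h1 ⊢
      calc Real.log |(x : ℝ)| ≤ Real.log (max |(x : ℝ)| 1) := Real.log_le_log (by linarith) (le_max_left _ _)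
        _ = logHeight₁ (x : ℚ) := hx.symm
        _ ≤ _ := le_max_left _ _
    · rw [max_eq_right hxy] at h1 ⊢
      calc Real.log |(y : ℝ)| ≤ Real.log (max |(y : ℝ)| 1) := Real.log_le_log (by linarith) (le_max_left _ _)
        _ = logHeight₁ (y : ℚ) := hy.symm
        _ ≤ _ := le_max_right _ _

/-! ### Arithmetic of `N_S`, `f`, `a_S`, `α_S` -/

/-- `ord_p(N_S) = 1` for `p ∈ S` and `= 0` otherwise (`N_S = ∏_{p ∈ S} p` is squarefree).
[cite: VonkanelMatschke2023, §1 (eq:sunit), N_S = ∏_{p ∈ S} p] -/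
theorem factorization_primesProd {S : Finset ℕ} (hS : ∀ p ∈ S, p.Prime) (p : ℕ) :
    (primesProd S).factorization p = if p ∈ S then 1 else 0 := by
  classical
  rw [primesProd, Nat.factorization_prod fun q hq => (hS q hq).ne_zero, Finset.sum_apply']
  rw [Finset.sum_congr rfl fun q hq => by rw [(hS q hq).factorization]]
  simp [Finsupp.single_apply]

/-- `f = ∏_{p ∈ S} p^{ord_p(a)} ≥ 1`. [cite: VonkanelMatschke2023, §7.1 (f)] -/
theorem sPart_pos_of_prime {S : Finset ℕ} (hS : ∀ p ∈ S, p.Prime) (a : ℤ) : 0 < sPart S a :=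
  Finset.prod_pos fun p hp => pow_pos (hS p hp).pos _

/-- `f ∣ a` ("`f` the largest divisor of `a` which is only divisible by primes in `S`").
[cite: VonkanelMatschke2023, §7.1 (f)] -/
theorem sPart_dvd_natAbs {S : Finset ℕ} (hS : ∀ p ∈ S, p.Prime) (a : ℤ) : sPart S a ∣ a.natAbs := by
  classical
  unfold sPart
  induction S using Finset.induction_on with
  | empty => simp
  | insert p S hp ih =>
    have hS' : ∀ q ∈ S, q.Prime := fun q hq => hS q (Finset.mem_insert_of_mem hq)
    have hpp : p.Prime := hS p (Finset.mem_insert_self p S)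
    haveI : Fact p.Prime := ⟨hpp⟩
    rw [Finset.prod_insert hp]
    refine Nat.Coprime.mul_dvd_of_dvd_of_dvd ?_ pow_padicValNat_dvd (ih hS')
    exact Nat.Coprime.prod_right fun q hq =>
      Nat.coprime_pow_primes _ _ hpp (hS' q hq) (fun h => hp (h ▸ hq))

/-- `α_S = 1728 N_S r₂(a) ≥ 1728`. [cite: VonkanelMatschke2023, §7.1 (α_S)] -/
theorem le_alphaLevel {S : Finset ℕ} (hS : ∀ p ∈ S, p.Prime) (a : ℚ) : 1728 ≤ alphaLevel S a := by
  have h1 : 1 ≤ primesProd S := one_le_primesProd hS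
  have h2 : 1 ≤ coprimePartTrunc S a := by
    rw [coprimePartTrunc]
    exact Nat.one_le_iff_ne_zero.mpr (Finset.prod_ne_zero_iff.mpr fun p hp =>
      pow_ne_zero _ (Nat.prime_of_mem_primeFactors (Finset.mem_sdiff.mp hp).1).ne_zero)
  calc 1728 = 1728 * 1 * 1 := by norm_num
    _ ≤ 1728 * primesProd S * coprimePartTrunc S a :=
      Nat.mul_le_mul (Nat.mul_le_mul_left _ h1) h2

/-- `a' ∣ a` (`a ≠ 0` integers) implies `a'_S ∣ a_S` ("and hence … since `a' ∣ a`").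
[cite: VonkanelMatschke2023, §10.3 (proof of Cor. 7.3: a' ∣ a)] -/
theorem mordellLevel_intCast_dvd_of_dvd {S : Finset ℕ} {a b : ℤ} (hb : b ≠ 0) (h : a ∣ b) :
    mordellLevel S (a : ℚ) ∣ mordellLevel S (b : ℚ) := by
  rw [mordellLevel_def, mordellLevel_def, Rat.num_intCast, Rat.num_intCast]
  refine Nat.mul_dvd_mul_left _ ?_
  have h' : a.natAbs ∣ b.natAbs := Int.natAbs_dvd_natAbs.mpr h
  have hb' : b.natAbs ≠ 0 := Int.natAbs_ne_zero.mpr hb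
  have ha' : a.natAbs ≠ 0 := fun h0 => hb' (Nat.eq_zero_of_zero_dvd (h0 ▸ h'))
  have hval : ∀ p : ℕ, p.Prime → padicValNat p a.natAbs ≤ padicValNat p b.natAbs := by
    intro p hp
    have := (Nat.factorization_le_iff_dvd ha' hb').mpr h' p
    rwa [Nat.factorization_def _ hp, Nat.factorization_def _ hp] at this
  have hsub : a.natAbs.primeFactors \ S ⊆ b.natAbs.primeFactors \ S :=
    Finset.sdiff_subset_sdiff (Nat.primeFactors_mono h' hb') le_rfl
  refine (Finset.prod_dvd_prod_of_dvd _ _ fun p hp => ?_).trans (Finset.prod_dvd_prod_of_subset _ _ _ hsub)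
  exact pow_dvd_pow p (min_le_min_left 2 (hval p (Nat.prime_of_mem_primeFactors (Finset.mem_sdiff.mp hp).1)))

/-! ### Definition 7.1 for integers: `u₁ = 1`, `u = 1/m` -/

/-- **The reduction of an integral pair** (§10.3, proof of Cor. 7.3: *"Let `m = u₂ ∈ ℤ` be maximal such that
`m⁶ ∣ gcd(x³, y²)`, and define `x' = m⁻²x` and `y' = m⁻³y`. Then `(x', y') ∈ ℤ × ℤ` is … primitive"*): for
`(x, y) ∈ ℤ × ℤ ∖ {(0,0)}` there are `m ≥ 1` and `x', y' ∈ ℤ` with `x = m²x'`, `y = m³y'`, `(x', y')` primitive and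
`u_{x,y} = 1/m`. [cite: VonkanelMatschke2023, Def. 7.1 and §10.3 (proof of Cor. 7.3)] -/
theorem exists_primitive_reduction_int {x y : ℤ} (h0 : ¬ (x = 0 ∧ y = 0)) :
    ∃ (m : ℕ) (x' y' : ℤ), 1 ≤ m ∧ x = (m : ℤ) ^ 2 * x' ∧ y = (m : ℤ) ^ 3 * y' ∧
      IsPrimitivePair x' y' ∧ uRatio (x : ℚ) (y : ℚ) = ((m : ℚ))⁻¹ := by
  have h1 : uOne (x : ℚ) (y : ℚ) = 1 := uOne_intCast x y
  have hX : ((uOne (x : ℚ) (y : ℚ) : ℕ) : ℚ) ^ 2 * (x : ℚ) = ((x : ℤ) : ℚ) := by rw [h1]; simp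
  have hY : ((uOne (x : ℚ) (y : ℚ) : ℕ) : ℚ) ^ 3 * (y : ℚ) = ((y : ℤ) : ℚ) := by rw [h1]; simp
  obtain ⟨hm1, hmdvd, hmax⟩ := uTwo_spec hX hY h0
  set m : ℕ := uTwo (x : ℚ) (y : ℚ) with hm
  have hg : ((m : ℤ)) ^ 6 ∣ (Int.gcd (x ^ 3) (y ^ 2) : ℤ) := by exact_mod_cast hmdvd
  have hdX : (m : ℤ) ^ 2 ∣ x := by
    have h2 : ((m : ℤ) ^ 2) ^ 3 ∣ x ^ 3 := by
      rw [← pow_mul]; exact hg.trans (Int.gcd_dvd_left _ _)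
    exact (Int.pow_dvd_pow_iff (by norm_num)).mp h2
  have hdY : (m : ℤ) ^ 3 ∣ y := by
    have h2 : ((m : ℤ) ^ 3) ^ 2 ∣ y ^ 2 := by
      rw [← pow_mul]; exact hg.trans (Int.gcd_dvd_right _ _)
    exact (Int.pow_dvd_pow_iff (by norm_num)).mp h2
  obtain ⟨x', hx'⟩ := hdX
  obtain ⟨y', hy'⟩ := hdY
  refine ⟨m, x', y', hm1, hx', hy', ?_, ?_⟩
  · intro n h3 h2
    have hn0 : n ≠ 0 := by
      rintro rfl
      have hx0 : x' = 0 := by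
        have : x' ^ 3 = 0 := by simpa using h3
        exact pow_eq_zero_iff (by norm_num) |>.mp this
      have hy0 : y' = 0 := by
        have : y' ^ 2 = 0 := by simpa using h2
        exact pow_eq_zero_iff (by norm_num) |>.mp this
      exact h0 ⟨by rw [hx', hx0]; ring, by rw [hy', hy0]; ring⟩
    have h3' : ((n.natAbs * m : ℕ) : ℤ) ^ 6 ∣ x ^ 3 := by
      have e : x ^ 3 = ((m : ℤ) ^ 2) ^ 3 * x' ^ 3 := by rw [hx']; ring
      rw [e]
      have : ((n.natAbs * m : ℕ) : ℤ) ^ 6 = ((m : ℤ) ^ 2) ^ 3 * (n.natAbs : ℤ) ^ 6 := by push_cast; ring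
      rw [this, Int.natCast_natAbs, show |n| ^ 6 = n ^ 6 by rw [← abs_pow, abs_of_nonneg (by positivity)]]
      exact mul_dvd_mul_left _ h3
    have h2' : ((n.natAbs * m : ℕ) : ℤ) ^ 6 ∣ y ^ 2 := by
      have e : y ^ 2 = ((m : ℤ) ^ 3) ^ 2 * y' ^ 2 := by rw [hy']; ring
      rw [e]
      have : ((n.natAbs * m : ℕ) : ℤ) ^ 6 = ((m : ℤ) ^ 3) ^ 2 * (n.natAbs : ℤ) ^ 6 := by push_cast; ring
      rw [this, Int.natCast_natAbs, show |n| ^ 6 = n ^ 6 by rw [← abs_pow, abs_of_nonneg (by positivity)]]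
      exact mul_dvd_mul_left _ h2
    have hg' : (n.natAbs * m) ^ 6 ∣ Int.gcd (x ^ 3) (y ^ 2) := by
      have := Int.dvd_coe_gcd h3' h2'
      exact_mod_cast this
    have hle := hmax _ hg'
    have hn1 : n.natAbs ≤ 1 := by
      by_contra hlt
      have : 2 * m ≤ n.natAbs * m := Nat.mul_le_mul_right _ (by omega)
      omega
    have hn1' : n.natAbs = 1 := by
      have : n.natAbs ≠ 0 := Int.natAbs_ne_zero.mpr hn0
      omega
    rcases Int.natAbs_eq n with h | h <;> [left; right] <;> omega
  · rw [uRatio, h1, ← hm]; simp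

/-! ### `N_E ∣ 6 α_S` -/

/-- **The conductor step of the proof of Cor. 7.3** (PROVED): *"Lemma 10.4 (ii) gives that `E` is semi-stable at
each `p ∈ S` with `p ≥ 5`, since `gcd(x', y', N_S) = 1`. Then (the proof of) Lemma 10.3 shows that `N_E` divides
`6 · 1728 N_S r₂(a')`, and hence we obtain that `N_E ∣ 6α_S` since `a' ∣ a`."* Here: for `p ∈ S`, `p ≥ 5`,
semistability gives `f_p ≤ 1 ≤ ord_p(6α_S)` (Silverman ATAEC IV.10.2 (a),(b)); for the other primes
`ord_p(N_E) ≤ ord_p(a'_S) ≤ ord_p(a_S) = ord_p(N_S) + ord_p(α_S) ≤ ord_p(6) + ord_p(α_S)`.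
[cite: VonkanelMatschke2023, §10.3 (proof of Cor. 7.3, cor:coates1)] -/
theorem conductorNorm_dvd_six_mul_alphaLevel {S : Finset ℕ} (hS : ∀ p ∈ S, p.Prime) {a a' x' y' : ℤ}
    (ha : a ≠ 0) (ha'a : a' ∣ a) (hcop : ∀ p ∈ S, ¬ ((p : ℤ) ∣ x' ∧ (p : ℤ) ∣ y'))
    (W : WeierstrassCurve ℚ) [W.IsElliptic]
    (hN : W.conductorNorm ℤ ∣ mordellLevel S (a' : ℚ))
    (hsemi : ∀ v : HeightOneSpectrum ℤ, 5 ≤ Ideal.absNorm v.asIdeal →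
      ¬ ((Ideal.absNorm v.asIdeal : ℤ) ∣ x' ∧ (Ideal.absNorm v.asIdeal : ℤ) ∣ y') → W.IsSemistableAt v) :
    W.conductorNorm ℤ ∣ 6 * alphaLevel S (a : ℚ) := by
  have hα0 : alphaLevel S (a : ℚ) ≠ 0 := by have := le_alphaLevel hS (a : ℚ); omega
  have hNS0 : primesProd S ≠ 0 := by have := one_le_primesProd hS; omega
  have h6α0 : 6 * alphaLevel S (a : ℚ) ≠ 0 := mul_ne_zero (by norm_num) hα0
  have hN0 : W.conductorNorm ℤ ≠ 0 := (conductorNorm_pos_holds W).ne'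
  have hM'0 : mordellLevel S (a' : ℚ) ≠ 0 := by have := le_mordellLevel hS (a' : ℚ); omega
  have hM0 : mordellLevel S (a : ℚ) ≠ 0 := by have := le_mordellLevel hS (a : ℚ); omega
  refine conductorNorm_dvd_of_forall_conductorExponent_le W h6α0 fun q => ?_
  obtain ⟨p, hp⟩ := q
  show W.conductorExponent ((primesEquiv (R := ℤ)).symm ⟨p, hp⟩) ≤ (6 * alphaLevel S (a : ℚ)).factorization p
  by_cases h5 : p ∈ S ∧ 5 ≤ p
  · -- semistable at `p`: `f_p ≤ 1 ≤ ord_p(6 α_S)`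
    set v : HeightOneSpectrum ℤ := (primesEquiv (R := ℤ)).symm ⟨p, hp⟩ with hv
    have habs : Ideal.absNorm v.asIdeal = p := by
      rw [absNorm_asIdeal_eq_natGenerator, hv, Rat.natGenerator_primesEquiv_symm]
    have hsv : W.IsSemistableAt v :=
      hsemi v (by rw [habs]; exact h5.2) (by rw [habs]; exact hcop p h5.1)
    have hf : W.conductorExponent v ≤ 1 := by
      rw [WeierstrassCurve.IsSemistableAt, ← conductorExponent_eq_zero_iff_holds v W,
        ← conductorExponent_eq_one_iff_holds v W] at hsv
      omega
    have h1 : 1 ≤ (6 * alphaLevel S (a : ℚ)).factorization p := by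
      refine (hp.dvd_iff_one_le_factorization h6α0).mp (Dvd.dvd.mul_left ?_ 6)
      rw [alphaLevel]
      refine Dvd.dvd.mul_right (Dvd.dvd.mul_left ?_ _) _
      rw [primesProd]; exact Finset.dvd_prod_of_mem _ h5.1
    exact hf.trans h1
  · -- `ord_p(N_E) ≤ ord_p(a'_S) ≤ ord_p(a_S) = ord_p(N_S) + ord_p(α_S) ≤ ord_p(6 α_S)`
    rw [← factorization_conductorNorm_primesEquiv_symm]
    show (W.conductorNorm ℤ).factorization p ≤ (6 * alphaLevel S (a : ℚ)).factorization p
    have h1 : (W.conductorNorm ℤ).factorization p ≤ (mordellLevel S (a' : ℚ)).factorization p :=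
      (Nat.factorization_le_iff_dvd hN0 hM'0).mpr hN p
    have h2 : (mordellLevel S (a' : ℚ)).factorization p ≤ (mordellLevel S (a : ℚ)).factorization p :=
      (Nat.factorization_le_iff_dvd hM'0 hM0).mpr (mordellLevel_intCast_dvd_of_dvd ha ha'a) p
    have h3 : (mordellLevel S (a : ℚ)).factorization p ≤ (6 * alphaLevel S (a : ℚ)).factorization p := by
      rw [← alphaLevel_mul_primesProd, Nat.factorization_mul hα0 hNS0, Nat.factorization_mul (by norm_num) hα0,
        Finsupp.add_apply, Finsupp.add_apply, factorization_primesProd hS]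
      split_ifs with hpS
      · have hp5 : p < 5 := by by_contra h; exact h5 ⟨hpS, by omega⟩
        have hp6 : p ∣ 6 := by
          rcases hp.eq_two_or_odd' with rfl | ⟨k, hk⟩
          · norm_num
          · have h2le := hp.two_le
            obtain rfl : p = 3 := by omega
            norm_num
        have := (hp.dvd_iff_one_le_factorization (by norm_num)).mp hp6
        omega
      · simp
    exact h1.trans (h2.trans h3)

/-! ### Corollary 7.3 from the roots -/

/-- **vKM Corollary 7.3 ⟸ {modularity, Lemma 10.4, Prop. 10.8 (i)}** (PROVED: the printed proof of §10.3 —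
reduction `x = m²x'`, `y = m³y'` to a primitive pair, `m⁶ ∣ a/f`, the curve of Lemma 10.4 with `N_E ∣ 6α_S`, and
the proof of Thm. 7.2 (i) with `a_S` replaced by `6α_S` and `μ = (1/6) log|a/f|`; Prop. 10.8 (ii), (eq:nuineq) and
the conductor–reduction dictionary are theorems of the tree). The named fact `corollary_7_3` is no longer an
independent root. [cite: VonkanelMatschke2023, Cor. 7.3 (arXiv §7.1, cor:coates1) with §10.3 (Proof of Corollary (cor:coates1))] -/
theorem corollary_7_3_of_roots (hmod : nonempty_modularParametrizationData)
    (h104 : vonKanelMatschke_lemma_10_4) (hi : vonKanelMatschke_prop_10_8_i) : corollary_7_3 := by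
  intro S hS a ha x y hxy hgcd
  classical
  have hκ := vkmKappa_le
  have hl2 := Real.log_two_lt_d9
  -- Step 0: `(x, y) ≠ (0, 0)`
  have h0 : ¬ (x = 0 ∧ y = 0) := by
    rintro ⟨rfl, rfl⟩; apply ha; rw [← hxy]; norm_num
  -- Step 1: the reduction `x = m² x'`, `y = m³ y'`, `a = m⁶ a'`
  obtain ⟨m, x', y', hm1, hx, hy, hprim, -⟩ := exists_primitive_reduction_int h0
  set a' : ℤ := y' ^ 2 - x' ^ 3 with ha'def
  have haa' : a = (m : ℤ) ^ 6 * a' := by rw [← hxy, hx, hy, ha'def]; ring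
  have ha'0 : a' ≠ 0 := by intro h; apply ha; rw [haa', h, mul_zero]
  have hsol : y' ^ 2 = x' ^ 3 + a' := by rw [ha'def]; ring
  -- `gcd(x, y, N_S) = 1`: for `p ∈ S`, `¬(p ∣ x ∧ p ∣ y)`, hence `¬(p ∣ x' ∧ p ∣ y')` and `p ∤ m`
  have hcop : ∀ p ∈ S, ¬ ((p : ℤ) ∣ x ∧ (p : ℤ) ∣ y) := by
    rintro p hp ⟨hpx, hpy⟩
    have h1 : (p : ℤ) ∣ (Int.gcd x y : ℤ) := Int.dvd_coe_gcd hpx hpy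
    have h2 : (p : ℤ) ∣ (primesProd S : ℤ) := by
      rw [primesProd]; push_cast; exact Finset.dvd_prod_of_mem _ hp
    have h3 : (p : ℤ) ∣ (Int.gcd (Int.gcd x y : ℤ) (primesProd S : ℤ) : ℤ) := Int.dvd_coe_gcd h1 h2
    rw [hgcd] at h3
    exact (hS p hp).not_dvd_one (by exact_mod_cast h3)
  have hcop' : ∀ p ∈ S, ¬ ((p : ℤ) ∣ x' ∧ (p : ℤ) ∣ y') := by
    rintro p hp ⟨hpx, hpy⟩
    exact hcop p hp ⟨hx ▸ hpx.mul_left _, hy ▸ hpy.mul_left _⟩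
  have hpm : ∀ p ∈ S, ¬ p ∣ m := by
    intro p hp hdvd
    have h' : (p : ℤ) ∣ (m : ℤ) := by exact_mod_cast hdvd
    exact hcop p hp ⟨hx ▸ (dvd_pow h' (by norm_num)).mul_right _, hy ▸ (dvd_pow h' (by norm_num)).mul_right _⟩
  -- Step 2: `m⁶ f ∣ |a|`, so `6 log m ≤ log(|a|/f)`
  have hf0 : 0 < sPart S a := sPart_pos_of_prime hS a
  have hfdvd : sPart S a ∣ a.natAbs := sPart_dvd_natAbs hS a
  have hm6 : m ^ 6 ∣ a.natAbs :=
    ⟨a'.natAbs, by rw [haa', Int.natAbs_mul, Int.natAbs_pow, Int.natAbs_natCast]⟩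
  have hcopf : Nat.Coprime (m ^ 6) (sPart S a) := by
    refine Nat.Coprime.pow_left _ ?_
    rw [sPart]
    exact Nat.Coprime.prod_right fun p hp => Nat.Coprime.pow_right _
      (Nat.coprime_comm.mp ((Nat.Prime.coprime_iff_not_dvd (hS p hp)).mpr (hpm p hp)))
  have haN0 : a.natAbs ≠ 0 := Int.natAbs_ne_zero.mpr ha
  have hle : m ^ 6 * sPart S a ≤ a.natAbs :=
    Nat.le_of_dvd (Nat.pos_of_ne_zero haN0) (hcopf.mul_dvd_of_dvd_of_dvd hm6 hfdvd)
  have hm0 : (0 : ℝ) < m := by exact_mod_cast hm1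
  have hleR : (m : ℝ) ^ 6 ≤ (a.natAbs : ℝ) / sPart S a := by
    rw [le_div_iff₀ (by exact_mod_cast hf0)]; exact_mod_cast hle
  have hlogm : 6 * Real.log m ≤ Real.log ((a.natAbs : ℝ) / sPart S a) := by
    have := Real.log_le_log (by positivity) hleR
    rwa [Real.log_pow, Nat.cast_ofNat] at this
  have hlogm0 : 0 ≤ Real.log m := Real.log_nonneg (by exact_mod_cast hm1)
  -- Step 3: `h(x) ≤ 2 log m + h(x')`, `h(y) ≤ 3 log m + h(y')`
  have hmh : logHeight₁ ((m : ℚ)) = Real.log m := by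
    haveI : NeZero m := ⟨by omega⟩
    exact Rat.logHeight₁_natCast m
  have hhx : logHeight₁ (x : ℚ) ≤ 2 * Real.log m + logHeight₁ (x' : ℚ) := by
    have e : (x : ℚ) = (m : ℚ) ^ 2 * (x' : ℚ) := by rw [hx]; push_cast; ring
    have h1 := logHeight₁_mul_le ((m : ℚ) ^ 2) (x' : ℚ)
    rw [← e, logHeight₁_pow, hmh] at h1; push_cast at h1; linarith
  have hhy : logHeight₁ (y : ℚ) ≤ 3 * Real.log m + logHeight₁ (y' : ℚ) := by
    have e : (y : ℚ) = (m : ℚ) ^ 3 * (y' : ℚ) := by rw [hy]; push_cast; ring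
    have h1 := logHeight₁_mul_le ((m : ℚ) ^ 3) (y' : ℚ)
    rw [← e, logHeight₁_pow, hmh] at h1; push_cast at h1; linarith
  -- Step 4: the curve of Lemma 10.4 for `(x', y')`, modular of level `N_E ≥ 11`, `N_E ∣ 6 α_S`
  obtain ⟨W, hW, hWmin, u, -, -, -, hNdvd, -, hsemi, hbound⟩ := h104 S hS a' ha'0 x' y' hprim hsol
  haveI := hW
  haveI := hWmin
  haveI : NeZero (W.conductorNorm ℤ) := ⟨(conductorNorm_pos_holds W).ne'⟩
  obtain ⟨D⟩ := hmod W
  have hN11 : 11 ≤ W.conductorNorm ℤ := eleven_le_conductorNorm_of_modularity hmod W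
  have h2h := two_mul_height_le_of_prop_10_8_i hi W (W.conductorNorm ℤ) rfl hN11 D
  have hL := hbound D.L D.isNeronLattice
  have hNdvd' : W.conductorNorm ℤ ∣ mordellLevel S (a' : ℚ) := by exact_mod_cast hNdvd
  have ha'a : a' ∣ a := ⟨(m : ℤ) ^ 6, by rw [haa']; ring⟩
  have hNM : W.conductorNorm ℤ ∣ 6 * alphaLevel S (a : ℚ) :=
    conductorNorm_dvd_six_mul_alphaLevel hS ha ha'a hcop' W hNdvd' hsemi
  -- Step 5: the bookkeeping of the proof of Thm. 7.2 (i) with `M = 6 α_S`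
  have hα := le_alphaLevel hS (a : ℚ)
  have hM : 1728 ≤ 6 * alphaLevel S (a : ℚ) := by omega
  have h4 : 4 ∣ 6 * alphaLevel S (a : ℚ) :=
    ⟨2592 * primesProd S * coprimePartTrunc S a, by rw [alphaLevel]; ring⟩
  have h9 : 9 ∣ 6 * alphaLevel S (a : ℚ) :=
    ⟨1152 * primesProd S * coprimePartTrunc S a, by rw [alphaLevel]; ring⟩
  obtain ⟨hν, hν1, hν3, hl3M, hlogM, -⟩ := nu_terms_le hN11 hNM hM h4 h9
  set α : ℝ := (alphaLevel S (a : ℚ) : ℝ) with hαdef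
  have hα' : (1728 : ℝ) ≤ α := by rw [hαdef]; exact_mod_cast hα
  have hMα : ((6 * alphaLevel S (a : ℚ) : ℕ) : ℝ) = 6 * α := by rw [hαdef]; push_cast; ring
  rw [hMα] at hν hν1 hν3 hl3M hlogM
  have hν0 := condNu_nonneg (W.conductorNorm ℤ)
  have h2h' : 2 * neronLatticeHeight D.L ≤ vkmKappa + (1 / 9 * (6 * α) * Real.log (6 * α) +
      1 / 24 * (6 * α) * Real.log (Real.log (Real.log (6 * α))) + 2 / 27 * (6 * α)) := by linarith
  have hlogmax := two_log_max_le_of_two_mul_le (show (1728 : ℝ) ≤ 6 * α by linarith) h2h'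
  set h : ℝ := neronLatticeHeight D.L with hhdef
  -- `B = 4h + 2 log max(1,h) + 28 ≥ max(h(x'), (2/3)h(y')) ≥ 0`
  have hx' : logHeight₁ (x' : ℚ) ≤ 4 * h + 2 * Real.log (max 1 h) + 28 := (le_max_left _ _).trans hL
  have hy' : 2 / 3 * logHeight₁ (y' : ℚ) ≤ 4 * h + 2 * Real.log (max 1 h) + 28 := (le_max_right _ _).trans hL
  have hB0 : 0 ≤ 4 * h + 2 * Real.log (max 1 h) + 28 := (zero_le_logHeight₁ _).trans hx'
  -- `log(6α) = log α + log 6`, `log₃(6α) ≤ log₃ α + 0.28`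
  have hα0 : 0 < α := by linarith
  have hlog6 : Real.log 6 ≤ 2.08 := by
    have h' : Real.log (6 : ℝ) ≤ Real.log 8 := Real.log_le_log (by norm_num) (by norm_num)
    rw [show (8 : ℝ) = 2 ^ 3 by norm_num, Real.log_pow] at h'; push_cast at h'; linarith
  have e1 : Real.log (6 * α) = Real.log α + Real.log 6 := by
    rw [Real.log_mul (by norm_num) hα0.ne']; ring
  have p1 : α * Real.log (6 * α) ≤ α * Real.log α + 2.08 * α := by
    rw [e1, mul_add]; nlinarith
  have p2 : α * Real.log (Real.log (Real.log (6 * α))) ≤ α * Real.log (Real.log (Real.log α)) + 0.28 * α := by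
    have := mul_le_mul_of_nonneg_left (l3_six_mul_le hα') hα0.le
    linarith
  -- Step 6: assemble
  have hfin : 3 / 2 * (4 * h + 2 * Real.log (max 1 h) + 28) ≤
      2 * α * Real.log α + 3 / 4 * α * Real.log (Real.log (Real.log α)) + 6 * α := by
    nlinarith
  have hmax : max (logHeight₁ (x : ℚ)) (logHeight₁ (y : ℚ)) ≤
      1 / 2 * Real.log ((a.natAbs : ℝ) / sPart S a) +
        (2 * α * Real.log α + 3 / 4 * α * Real.log (Real.log (Real.log α)) + 6 * α) :=
    max_le (by linarith) (by linarith)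
  have := log_max_abs_le x y
  rw [hαdef] at hmax
  linarith

end VonKanelMatschke

end Literature.NumberTheory.DiophantineGeometry

end
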